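import Summits.CriticalPhenomena.SAWScalingLimit.Theses.SAWTotalPositivity
import Summits.CriticalPhenomena.SAWScalingLimit.Theorems.CriticalBubbleBound.Negative.CriticalBubbleBoundLatticeKernel

/-!
# Negative-side file for the crux `SAWTotalPositivity.TPToTraversalBound` (stmt-CriticalPhenomena-10687):
POSITIVE AUDIT — the sketch lemma `MirrorMonotone` (ideator 2, card `mirror-monotone-decay`) follows from TP₂;
reflection equivariance of the whole discretisation pipeline and reversal symmetry of the critical kernel

Refuter `cdisprove` (standing adversary, cycle 3); work file
`Summits/CriticalPhenomena/SAWScalingLimit/Cruxes/TPToTraversalBound/Disproof.lean` §9.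
`reflSite` is a VERBATIM copy of `Sketch.reflSite` and `mirrorMonotone` has verbatim the hypotheses / binders /
conclusion of `Sketch.MirrorMonotone` (`Cruxes/TPToTraversalBound/SketchIdeator2.lean`): `BoundaryTP2` at the
cyclic quadruple `(m, t, t̄, m̄)` gives `Z(m,t̄)·Z(t,m̄) ≤ Z(m,t)·Z(t̄,m̄)`, and the two identities
`Z(t,m̄) = Z(m,t̄)`, `Z(t̄,m̄) = Z(m,t)` follow from
* `weight_univ_reflSite` — REFLECTION EQUIVARIANCE `Z(ū,v̄) = Z(u,v)` for `conj '' Ω = Ω`, which needs the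
  symmetry of every stage `meshVertices → meshGraph (segments in the closure) → meshVertexGraph → connected
  components and their `ncard` (largest-component convention) → meshDomain → discreteDomainGraph → DomainSAW`
  (`reflSite_mem_meshDomain`, `discreteDomainGraph_adj_reflSite`, `reflHom`), and
* `weight_univ_symm` — REVERSAL `Z(u,v) = Z(v,u)`.
Both are reusable for every D₄ / reversal argument of the crux's idea cards.  Axioms standard.
-/

namespace Summit.CriticalPhenomena.SAWScalingLimit.Theorems.TPToTraversalBound.Negative

open scoped BigOperators ENNReal ComplexConjugate
open MeasureTheory Filter Set Function Literature.Probability.LatticeModels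
open Literature.Probability.RandomPlanarGeometry Literature.Probability.RandomPlanarGeometry.SAW
open Summit.CriticalPhenomena.SAWScalingLimit.Theorems.CriticalBubbleBound.Negative (weight_univ)
open Summit.CriticalPhenomena.SAWScalingLimit.Theses.SAWTotalPositivity


/-- Verbatim copy of `Sketch.reflSite` (ideator 2): reflection of a site in the real axis, `(x, y) ↦ (x, -y)`. -/
def reflSite (v : Site 2) : Site 2 := ![v 0, -v 1]

/-- `reflSite` is an involution. [folklore] -/
theorem reflSite_reflSite (v : Site 2) : reflSite (reflSite v) = v := by
  funext i; fin_cases i <;> simp [reflSite]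

/-- `reflSite` is injective. [folklore] -/
theorem reflSite_injective : Injective reflSite := fun a b h => by
  rw [← reflSite_reflSite a, h, reflSite_reflSite]

/-- Mesh points commute with the reflection: `δ·(x,-y) = conj (δ·(x,y))`. [folklore] -/
theorem meshPoint_reflSite (δ : ℝ) (v : Site 2) : meshPoint δ (reflSite v) = conj (meshPoint δ v) := by
  apply Complex.ext
  · simp [meshPoint_re, reflSite]
  · simp [meshPoint_im, reflSite]

/-- `reflSite` is an automorphism of `ℤ²`. [folklore] -/
theorem zdGraph_adj_reflSite {x y : Site 2} (h : (zdGraph 2).Adj x y) :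
    (zdGraph 2).Adj (reflSite x) (reflSite y) := by
  rw [zdGraph_adj_iff] at h ⊢
  obtain ⟨i, h | h⟩ := h
  · subst h
    fin_cases i
    · exact ⟨0, Or.inl (by funext j; fin_cases j <;> simp [reflSite])⟩
    · exact ⟨1, Or.inr (by funext j; fin_cases j <;> simp [reflSite])⟩
  · subst h
    fin_cases i
    · exact ⟨0, Or.inr (by funext j; fin_cases j <;> simp [reflSite])⟩
    · exact ⟨1, Or.inl (by funext j; fin_cases j <;> simp [reflSite])⟩

/-- Segments between reflected mesh points are the conjugates of the original segments. [folklore] -/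
theorem segment_reflSite (δ : ℝ) (x y : Site 2) :
    segment ℝ (meshPoint δ (reflSite x)) (meshPoint δ (reflSite y)) =
      conj '' segment ℝ (meshPoint δ x) (meshPoint δ y) := by
  rw [meshPoint_reflSite, meshPoint_reflSite]
  have h := image_segment ℝ ((Complex.conjLIE : ℂ ≃ₗᵢ[ℝ] ℂ).toLinearEquiv.toLinearMap.toAffineMap)
    (meshPoint δ x) (meshPoint δ y)
  have hcoe : ⇑((Complex.conjLIE : ℂ ≃ₗᵢ[ℝ] ℂ).toLinearEquiv.toLinearMap.toAffineMap) = conj := by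
    funext z; simp
  rw [hcoe] at h
  exact h.symm

/-- A conjugation-symmetric set has a conjugation-symmetric closure. [folklore] -/
theorem conj_mem_closure {Ω : Set ℂ} (hΩ : conj '' Ω = Ω) {z : ℂ} (hz : z ∈ closure Ω) :
    conj z ∈ closure Ω := by
  have hpre : conj ⁻¹' Ω = Ω := by
    ext w
    constructor
    · intro hw
      rw [Set.mem_preimage, ← hΩ] at hw
      obtain ⟨w', hw', he⟩ := hw
      have : w' = w := by
        have := congrArg conj he
        simpa using this
      exact this ▸ hw'
    · intro hw
      rw [Set.mem_preimage, ← hΩ]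
      exact ⟨w, hw, rfl⟩
  have hsub := Complex.continuous_conj.closure_preimage_subset Ω
  rw [hpre] at hsub
  exact hsub hz

/-- Mesh vertices are reflection-symmetric for a conjugation-symmetric domain. [folklore] -/
theorem reflSite_mem_meshVertices {Ω : Set ℂ} (hΩ : conj '' Ω = Ω) {δ : ℝ} {x : Site 2}
    (hx : x ∈ meshVertices Ω δ) : reflSite x ∈ meshVertices Ω δ := by
  rw [mem_meshVertices_iff, meshPoint_reflSite, ← hΩ]
  exact ⟨_, hx, rfl⟩

/-- The mesh graph is reflection-symmetric for a conjugation-symmetric domain. [folklore] -/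
theorem meshGraph_adj_reflSite {Ω : Set ℂ} (hΩ : conj '' Ω = Ω) {δ : ℝ} {x y : Site 2}
    (h : (meshGraph Ω δ).Adj x y) : (meshGraph Ω δ).Adj (reflSite x) (reflSite y) := by
  rw [meshGraph_adj_iff] at h ⊢
  refine ⟨zdGraph_adj_reflSite h.1, ?_⟩
  rw [segment_reflSite]
  rintro _ ⟨z, hz, rfl⟩
  exact conj_mem_closure hΩ (h.2 hz)

/-- The reflection as a permutation of the mesh vertices. -/
def reflEquivVert {Ω : Set ℂ} (hΩ : conj '' Ω = Ω) (δ : ℝ) : meshVertices Ω δ ≃ meshVertices Ω δ where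
  toFun v := ⟨reflSite v.1, reflSite_mem_meshVertices hΩ v.2⟩
  invFun v := ⟨reflSite v.1, reflSite_mem_meshVertices hΩ v.2⟩
  left_inv v := Subtype.ext (reflSite_reflSite v.1)
  right_inv v := Subtype.ext (reflSite_reflSite v.1)

/-- The reflection as an automorphism of the mesh vertex graph. -/
def reflIsoVert {Ω : Set ℂ} (hΩ : conj '' Ω = Ω) (δ : ℝ) : meshVertexGraph Ω δ ≃g meshVertexGraph Ω δ where
  toEquiv := reflEquivVert hΩ δ
  map_rel_iff' := by
    intro a b
    simp only [SimpleGraph.comap_adj, Function.Embedding.subtype_apply]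
    constructor
    · intro h
      have := meshGraph_adj_reflSite hΩ h
      simpa [reflEquivVert, reflSite_reflSite] using this
    · intro h
      exact meshGraph_adj_reflSite hΩ h

/-- The discrete domain `Ω_δ` (largest-component convention included) is reflection-symmetric for a
conjugation-symmetric domain. [folklore] -/
theorem reflSite_mem_meshDomain {Ω : Set ℂ} (hΩ : conj '' Ω = Ω) {δ : ℝ} {x : Site 2}
    (hx : x ∈ meshDomain Ω δ) : reflSite x ∈ meshDomain Ω δ := by
  simp only [meshDomain, Set.mem_iUnion, Set.mem_image] at hx ⊢
  obtain ⟨C, hCmax, v, hv, rfl⟩ := hx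
  set φ := reflIsoVert hΩ δ with hφ
  have hcard : ∀ C : (meshVertexGraph Ω δ).ConnectedComponent,
      (φ.connectedComponentEquiv C).supp.ncard = C.supp.ncard := by
    intro C
    rw [← Nat.card_coe_set_eq, ← Nat.card_coe_set_eq]
    exact Nat.card_congr (SimpleGraph.ConnectedComponent.isoEquivSupp φ C).symm
  refine ⟨φ.connectedComponentEquiv C, fun C' => ?_,
    ⟨(SimpleGraph.ConnectedComponent.isoEquivSupp φ C ⟨v, hv⟩).1,
      (SimpleGraph.ConnectedComponent.isoEquivSupp φ C ⟨v, hv⟩).2, rfl⟩⟩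
  have h1 := hCmax (φ.connectedComponentEquiv.symm C')
  have h2 := hcard (φ.connectedComponentEquiv.symm C')
  rw [Equiv.apply_symm_apply] at h2
  rw [h2, hcard]
  exact h1

/-- The graph `Ω_δ` is reflection-symmetric for a conjugation-symmetric domain. [folklore] -/
theorem discreteDomainGraph_adj_reflSite {Ω : Set ℂ} (hΩ : conj '' Ω = Ω) {δ : ℝ} {x y : Site 2}
    (h : (discreteDomainGraph Ω δ).Adj x y) :
    (discreteDomainGraph Ω δ).Adj (reflSite x) (reflSite y) := by
  rw [discreteDomainGraph_adj_iff] at h ⊢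
  exact ⟨meshGraph_adj_reflSite hΩ h.1, reflSite_mem_meshDomain hΩ h.2.1, reflSite_mem_meshDomain hΩ h.2.2⟩

/-- The reflection as a graph homomorphism of `Ω_δ`. -/
def reflHom {Ω : Set ℂ} (hΩ : conj '' Ω = Ω) (δ : ℝ) : discreteDomainGraph Ω δ →g discreteDomainGraph Ω δ where
  toFun := reflSite
  map_rel' := discreteDomainGraph_adj_reflSite hΩ

/-- Reflection equivariance of the critical kernel, one inequality. [folklore] -/
theorem weight_univ_le_reflSite {Ω : Set ℂ} (hΩ : conj '' Ω = Ω) (δ : ℝ) (u v : Site 2) :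
    SAW.weight Ω δ u v Set.univ ≤ SAW.weight Ω δ (reflSite u) (reflSite v) Set.univ := by
  rw [weight_univ, weight_univ]
  let F : DomainSAW Ω δ u v → DomainSAW Ω δ (reflSite u) (reflSite v) := fun γ =>
    ⟨γ.walk.map (reflHom hΩ δ), γ.isPath.map reflSite_injective⟩
  have hF : Injective F := by
    rintro ⟨p, hp⟩ ⟨q, hq⟩ h
    have h' : p.map (reflHom hΩ δ) = q.map (reflHom hΩ δ) := congrArg DomainSAW.walk h
    have := SimpleGraph.Walk.map_injective_of_injective (f := reflHom hΩ δ) reflSite_injective u v h'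
    subst this
    rfl
  have key : (fun γ : DomainSAW Ω δ u v => ENNReal.ofReal (criticalFugacity ^ γ.length)) =
      fun γ => (fun γ' : DomainSAW Ω δ (reflSite u) (reflSite v) =>
        ENNReal.ofReal (criticalFugacity ^ γ'.length)) (F γ) := by
    funext γ
    exact congrArg (fun n : ℕ => ENNReal.ofReal (criticalFugacity ^ n))
      (SimpleGraph.Walk.length_map _ _).symm
  rw [key]
  exact ENNReal.tsum_comp_le_tsum_of_injective hF _

/-- **Reflection equivariance** of the critical kernel: `Z(ū, v̄) = Z(u, v)` when `conj Ω = Ω`. [folklore] -/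
theorem weight_univ_reflSite {Ω : Set ℂ} (hΩ : conj '' Ω = Ω) (δ : ℝ) (u v : Site 2) :
    SAW.weight Ω δ (reflSite u) (reflSite v) Set.univ = SAW.weight Ω δ u v Set.univ := by
  refine le_antisymm ?_ (weight_univ_le_reflSite hΩ δ u v)
  have h := weight_univ_le_reflSite hΩ δ (reflSite u) (reflSite v)
  rwa [reflSite_reflSite, reflSite_reflSite] at h

/-- Reversal symmetry of the critical kernel, one inequality. [folklore] -/
theorem weight_univ_le_reverse (Ω : Set ℂ) (δ : ℝ) (u v : Site 2) :
    SAW.weight Ω δ u v Set.univ ≤ SAW.weight Ω δ v u Set.univ := by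
  rw [weight_univ, weight_univ]
  let F : DomainSAW Ω δ u v → DomainSAW Ω δ v u := fun γ => ⟨γ.walk.reverse, γ.isPath.reverse⟩
  have hF : Injective F := by
    rintro ⟨p, hp⟩ ⟨q, hq⟩ h
    have h' : p.reverse = q.reverse := congrArg DomainSAW.walk h
    have h'' := congrArg SimpleGraph.Walk.reverse h'
    rw [SimpleGraph.Walk.reverse_reverse, SimpleGraph.Walk.reverse_reverse] at h''
    subst h''
    rfl
  have key : (fun γ : DomainSAW Ω δ u v => ENNReal.ofReal (criticalFugacity ^ γ.length)) =
      fun γ => (fun γ' : DomainSAW Ω δ v u => ENNReal.ofReal (criticalFugacity ^ γ'.length)) (F γ) := by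
    funext γ
    exact congrArg (fun n : ℕ => ENNReal.ofReal (criticalFugacity ^ n))
      (SimpleGraph.Walk.length_reverse _).symm
  rw [key]
  exact ENNReal.tsum_comp_le_tsum_of_injective hF _

/-- **Reversal symmetry** of the critical kernel: `Z(u, v) = Z(v, u)`. [folklore] -/
theorem weight_univ_symm (Ω : Set ℂ) (δ : ℝ) (u v : Site 2) :
    SAW.weight Ω δ u v Set.univ = SAW.weight Ω δ v u Set.univ :=
  le_antisymm (weight_univ_le_reverse Ω δ u v) (weight_univ_le_reverse Ω δ v u)

/-- CERTIFIED (positive audit of a sketch lemma): `Sketch.MirrorMonotone` (ideator 2, card `mirror-monotone-decay`;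
its hypotheses, binders and conclusion are reproduced VERBATIM, so
`fun hTP Ω δ m t => mirrorMonotone hTP Ω δ m t` inhabits the sketch `Prop`) holds: TP₂ at the cyclic quadruple
`(m, t, t̄, m̄)` gives `Z(m,t̄)·Z(t,m̄) ≤ Z(m,t)·Z(t̄,m̄)`; reflection equivariance (`weight_univ_reflSite`, which
needs the symmetry of the WHOLE discretisation pipeline `meshVertices → meshGraph → largest component → Ω_δ`)
and reversal (`weight_univ_symm`) turn this into `Z(m,t̄)² ≤ Z(m,t)²`.  The typed provisos are exactly
`BoundaryTP2`'s with `(p₁,p₂,p₃,p₄) = (m, t, t̄, m̄)`. [folklore] -/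
theorem mirrorMonotone (hTP : BoundaryTP2) (Ω : Set ℂ) (δ : ℝ) (m t : Site 2)
    (hB : Bornology.IsBounded Ω) (hS : SimplyConnectedSpace Ω) (hδ : 0 < δ)
    (hΩ : (starRingEnd ℂ) '' Ω = Ω)
    (h1 : ∀ (P : SAW.DomainSAW Ω δ m (reflSite t)) (Q : SAW.DomainSAW Ω δ t (reflSite m)),
        ∃ v, v ∈ P.walk.support ∧ v ∈ Q.walk.support)
    (h2 : ∃ (P : SAW.DomainSAW Ω δ m t) (Q : SAW.DomainSAW Ω δ (reflSite t) (reflSite m)),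
        List.Disjoint P.walk.support Q.walk.support)
    (h3 : ∃ (P : SAW.DomainSAW Ω δ m (reflSite m)) (Q : SAW.DomainSAW Ω δ t (reflSite t)),
        List.Disjoint P.walk.support Q.walk.support) :
    SAW.weight Ω δ m (reflSite t) Set.univ ≤ SAW.weight Ω δ m t Set.univ := by
  have key := hTP Ω δ m t (reflSite t) (reflSite m) hB hS hδ h1 h2 h3
  have e1 : SAW.weight Ω δ t (reflSite m) Set.univ = SAW.weight Ω δ m (reflSite t) Set.univ := by
    rw [← weight_univ_reflSite hΩ δ t (reflSite m), reflSite_reflSite, weight_univ_symm]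
  have e2 : SAW.weight Ω δ (reflSite t) (reflSite m) Set.univ = SAW.weight Ω δ m t Set.univ := by
    rw [weight_univ_reflSite hΩ, weight_univ_symm]
  rw [e1, e2] at key
  by_contra hlt
  exact absurd key (not_le.2 (ENNReal.mul_lt_mul (not_le.1 hlt) (not_le.1 hlt)))


end Summit.CriticalPhenomena.SAWScalingLimit.Theorems.TPToTraversalBound.Negative
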